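import Literature.MathematicalPhysics.QuantumFieldTheory.Balaban1983to89.B16Absorption
import Literature.MathematicalPhysics.QuantumFieldTheory.Balaban1983to89.B16StoppingRule

/-!
# `Balaban1983to89.B16MergeHorizon` — [Balaban1989LargeFieldII] p. 387, ll. 12–15: the HORIZON consequence
«K ≦ K₂ + n₁ + R_{j+1}» of the absorption sentence, DERIVED in the ℤᵈ index model from ONE-LAYER absorption
(`…B16Absorption.one_layer_absorption_dropCtl`) and the typed stopping rule (`…B16StoppingRule.StopAt`)
(cell `STEP.md` §11 row O-F4, residual binder `hsub` — its HORIZON half; `GAPS.md` rows G-b02g10-1 / C-b02g10-2 /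
C-b02g10-3; `DIVERGENCE.md` D-b02g10.2 / D-b02g10.3; unit b2b-balaban-b02, gen 10 — NEW leaf module, imports
`…B16Absorption` and `…B16StoppingRule` and modifies nothing)

CITATION HEADER (lean-in-tree rule 2026-08-18).  Source under audit: T. Bałaban, *Large field renormalization. II.
Localization, exponentiation, and bounds for the 𝐑 operation*, Commun. Math. Phys. **122**, 355–392 (1989)
[Balaban1989LargeFieldII] (cell paper B16; held `paper:balaban1989-cmp122-large-field-ii`, journal page = PDF page
+ 354).  The passage p. 387 [PDF 33] ll. 2–16 was READ AS AN IMAGE by the typist on the x2 render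
`b2b-balaban-ref1/pages/1989-cmp122-large-field-II/1989-cmp122-large-field-II-p033-x2.png` and is quoted in full in the
header of `…B16Absorption`; the definition of the number `K` (p. 384 [PDF 30]) and the conditions (i), (ii) of
[Balaban1989LargeFieldI] p. 177 are the ones typed by `…B16StoppingRule` (unit b02 gen 9; quoted verbatim in that
module's docstrings: *"the number K is the smallest positive integer having the property that the domain S^K(Z),
considered as a domain in the lattice of the scale L^{−(j+K)}, satisfies the conditions (i), (ii), with N = R_j"*;
*"(i) it is contained in a cube of the size 100 MR_k"*).  The paper is a manuscript UNDER ADJUDICATION by the audit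
cell `pub-balaban`: NOTHING printed in it is asserted here; every `theorem` below is finite combinatorics on `ℤᵈ` and
integer arithmetic, proved without `sorry` and without new axioms, over the EXISTING definitions
`B13ScaleTransfer.{Pt, block, collar}`, `B16SProfile.{Sop, Siter, ratio, qexp, DropCtl}`, `B16MergeGeometry.Touch`,
`B16Absorption.{pbox, env, envLo, cdiv, shrink, width, gains}`, `B16StoppingRule.{CondI, CondII, StopAt}`,
`B14BoxFix.{FitsIn, ibox}`, using BY NAME `B16Absorption.{one_layer_absorption_dropCtl, Sop_pbox_subset, mem_pbox,
env_le_env_add_shrink, env_sub_envLo_le_width, width_nonneg, shrink_le_cdiv_pow, cdiv_le_cdiv_two, cdiv_le_of_le_mul,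
cdiv_one, two_le_ratio_iff}`, `B16SProfile.{Sop_mono, Siter_succ, ratio_pos, DropCtl.lag_two}`,
`B16MergeGeometry.{Siter_union, exists_common_Siter}`, `B13ScaleTransfer.{mem_block, subset_collar}`.

THE PRINTED SENTENCE (p. 387 ll. 8–15): *"The domain S^{K₁}(X) satisfies the conditions (i), (ii), in particular it is
contained in a cube of the size 100MR_{j+1+K₁}, and it intersects the domains S^{K₁}(Y). It is clear that applying n₁
times the operation S to the last domain, where n₁ is a rather small number, e.g., n₁ < 10, we obtain the domain
S^{K₁+n₁}(Y) containing S^{K₁+n₁}(X). This implies that S^{n−j−1}(Z) = S^{n−j−1}(Y) for n ≧ j + 1 + K₁ + n₁, and that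
K ≦ K₂ + n₁ + R_{j+1}."*  `…B16Absorption` REFUTES the containment uniformly (`no_uniform_absorption`) and PROVES its
one-layer substitute `S^{m}(X) ⊆ (S^{m}(Y))^{~1}` from `m = 14` on under the drop control (`one_layer_absorption_dropCtl`).
THIS MODULE derives the second consequence — the bound on the stopping index `K` of `Z = X ∪ Y` — from the one-layer
substitute, in the model of `…B16StoppingRule` (conditions (i) = `CondI 100`, (ii) = `CondII 100 N Clean` with the
cleanliness predicate `Clean : ℕ → Prop` a PER-STEP PARAMETER, `K = Nat.find` of `StopAt`).

WHAT IS PROVED (unconditionally; every dimension `d`, every `L ≥ 2`, every exponent sequence `σ` with the drop control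
`DropCtl σ m'` of `…B16SProfile`, ratio sequence `q = ratio L σ`, i.e. `R_n = L^{σ n}`).
* Part 1 (shifts): `S^{s+t} = S'^{t} ∘ S^{s}` along the shifted ratio sequence (`Siter_add`), the drop control and the
  ratio sequence shift (`dropCtl_shift`, `ratio_shift_fun`).
* Part 2 (envelopes of a boxed domain): `S'^{t}(pbox lo hi) ⊆ pbox (envLo lo t) (env hi t)` (`Siter_pbox_subset`); the
  side of the orbit box is `≤ shrink (hi − lo) t + width t` (`env_sub_envLo_le`); one layer widens a box by one
  (`collar_pbox_subset`); `pbox`-containment ⇔ condition (i) (`fitsIn_of_subset_pbox`, `exists_pbox_of_fitsIn`).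
* Part 3 (the alternation arithmetic): under the drop control no two consecutive steps fail to gain (the hypothesis
  `∀ l, l + 2 ≤ m → 2 ≤ q l ∨ 2 ≤ q (l+1)`, `altGain_ratio`, from `DropCtl.lag_two`); hence `⌊t/2⌋ ≤ gains t` (`div_two_le_gains_of_altGain`), the layer width obeys
  `width t ≤ 80`, and `≤ 60` right after a gaining step (`width_le_eighty`: the recursion `w ↦ ⌈w/q⌉ + 20` with `q ≥ 2`
  at least every other step), and a distance `≤ 99` contracts to `≤ 13` after three gaining steps (`shrink_le_thirteen`).
* Part 4 (THE HORIZON THEOREM, relative indices — time `0` = print's scale `j + 1 + K₁`): if every cube of `X` is within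
  sup-distance `D ≤ 128` of a cube `c ∈ Y`, and `S^{s}(Y)` satisfies (i) (`100` cubes per side), then `S^{m}(X ∪ Y)`
  satisfies (i) for EVERY `m` with `m ≥ s + 6`, `m ≥ 14` on the horizon (`condI_union`: `S^{m}(X ∪ Y) ⊆ (S^{m}(Y))^{~1}`
  lies in the orbit box of `S^{s}(Y)`'s `100`-box widened by one layer, of side `≤ 13 + 80 + 3 = 96 ≤ 100`); hence the
  stopping property of `Z = X ∪ Y` holds at `max(s + 6, 14) + N − 1` (`stopAt_union`, cleanliness of the steps
  `1, …, m'` assumed as on p. 384: *"under the assumption that no large fields are created in these steps"*) and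
  `K = Nat.find ≤ max(s + 6, 14) + N − 1` (`find_stopAt_union_le`).
* Part 5 (ABSOLUTE indices, the printed shape): for `X, Y` touching at the creation scale (`a₀ ∈ X`, `c₀ ∈ Y`,
  `Touch a₀ c₀`), with stopping data `StopAt 100 N₁ Clean₁ (S^{·}X) K₁`, `StopAt 100 N₂ Clean₂ (S^{·}Y) K₂`, `K₁ ≤ K₂`:
  `S^{m}(X ∪ Y)` satisfies (i) for every `m ≥ max(K₂ + 6, K₁ + 14)` on the horizon (`condI_merge`), and the stopping
  index of `Z = X ∪ Y` with memory `N` obeys  `K ≤ max(K₂ + 6, K₁ + 14) + N − 1 ≤ K₂ + 13 + N`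
  (`find_stopAt_merge_le`, `find_stopAt_merge_le'`) — print's «K ≦ K₂ + n₁ + R_{j+1}» with `n₁ = 13` in place of
  «n₁ < 10» (the constant reflects the crude contraction `⌈·/2⌉` per gaining step used in `…B16Absorption`; nothing
  downstream is sensitive to it).

WHAT THIS SAYS ABOUT THE PRINTED STEP (value = the HORIZON half of the located gap G-b02g10-1 closed at kernel level in
the model; NOT summit progress).  Of the two consequences print draws from the (refuted) containment, the SECOND —
the bound on `K`, which caps the number of terms of the `Y`-type sum in (1.88) — survives with a uniform constant via
one-layer absorption: THIS module.  The FIRST — the cost identity `S^{n−j−1}(Z) = S^{n−j−1}(Y)`, i.e. the first `≦` of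
(1.88) with no overhang term — does NOT (per-scale overhang `≤ (width + 2·shrink + 1)^d` cubes,
`B16Absorption.card_Siter_union_le`; repair avenues ρ2/ρ3 of `GAPS.md` G-b02g10-1 need an in-print per-term slack or a
super-additivity margin of `κ_{j+1}`, neither printed).  CAVEAT (declared reading, cell `DIVERGENCE.md` D-b02g10.2/.3):
condition (ii)'s *"no new large field regions were created inside this component"* is the PER-STEP parameter `Clean` of
`…B16StoppingRule`, not a geometric predicate of the component; whether the extra layer `(S^{m}(Y))^{~1} ∖ S^{m}(Y)`
could carry new large-field regions is therefore NOT examined here (print, asserting containment, does not discuss it).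
-/

namespace Literature.MathematicalPhysics.QuantumFieldTheory.Balaban1983to89.B16MergeHorizon

open Literature.MathematicalPhysics.QuantumFieldTheory.Balaban1983to89
open Literature.MathematicalPhysics.QuantumFieldTheory.Balaban1983to89.B13ScaleTransfer
open Literature.MathematicalPhysics.QuantumFieldTheory.Balaban1983to89.B16SProfile
open Literature.MathematicalPhysics.QuantumFieldTheory.Balaban1983to89.B16MergeGeometry
open Literature.MathematicalPhysics.QuantumFieldTheory.Balaban1983to89.B16Absorption
open Literature.MathematicalPhysics.QuantumFieldTheory.Balaban1983to89.B16StoppingRule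

variable {d : ℕ}

section

/-! ## Part 1. Shifting the scale origin -/

/-- `S^{s+t}(Z) = S'^{t}(S^{s}(Z))` along the shifted ratio sequence `q'_l = q_{s+l}`. [folklore] -/
theorem Siter_add (q : ℕ → ℕ) (s : ℕ) (Z : Finset (Pt d)) :
    ∀ t, Siter q (s + t) Z = Siter (fun l => q (s + l)) t (Siter q s Z)
  | 0 => rfl
  | t + 1 => by
    show Sop (q (s + t)) (Siter q (s + t) Z) = Sop (q (s + t)) (Siter (fun l => q (s + l)) t (Siter q s Z))
    rw [Siter_add q s Z t]

/-- The drop control restricts to a shifted window. [folklore] -/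
theorem dropCtl_shift {σ : ℕ → ℕ} {m : ℕ} (h : DropCtl σ m) (a : ℕ) : DropCtl (fun l => σ (a + l)) (m - a) := by
  intro i k hik hk
  show 2 * σ (a + i) ≤ 2 * σ (a + k) + max (k - i) 2
  have h1 := h (a + i) (a + k) (by omega) (by omega)
  rw [show a + k - (a + i) = k - i by omega] at h1
  exact h1

/-- The ratio sequence of the shifted exponent sequence is the shifted ratio sequence. [folklore] -/
theorem ratio_shift (L : ℕ) (σ : ℕ → ℕ) (a l : ℕ) : ratio L (fun n => σ (a + n)) l = ratio L σ (a + l) := rfl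

/-- The same as an equality of sequences. [folklore] -/
theorem ratio_shift_fun (L : ℕ) (σ : ℕ → ℕ) (a : ℕ) :
    (fun l => ratio L σ (a + l)) = ratio L (fun n => σ (a + n)) :=
  funext fun l => (ratio_shift L σ a l).symm

/-- The iterated operation is monotone under inclusion. [folklore] -/
theorem Siter_subset_Siter (q : ℕ → ℕ) {X Y : Finset (Pt d)} (h : X ⊆ Y) : ∀ t, Siter q t X ⊆ Siter q t Y
  | 0 => h
  | t + 1 => by
    rw [Siter_succ, Siter_succ]
    exact Sop_mono _ (Siter_subset_Siter q h t)

/-! ## Part 2. Envelopes of a boxed domain; boxes versus condition (i) -/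

/-- THE ORBIT BOX OF A BOX: `S^{t}(pbox lo hi) ⊆ pbox (envLo lo t) (env hi t)` (coordinatewise orbits
`H ↦ ⌊H/q⌋ ∓ 10`). [cite: Balaban1989LargeFieldII, p.384 ("S^{n−j}(□) is a cube")] -/
theorem Siter_pbox_subset {q : ℕ → ℕ} (hq : ∀ l, 0 < q l) (lo hi : Pt d) :
    ∀ t, Siter q t (pbox lo hi) ⊆ pbox (fun i => envLo q (lo i) t) (fun i => env q (hi i) t)
  | 0 => by
    intro x hx
    simpa [mem_pbox] using hx
  | t + 1 => by
    rw [Siter_succ]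
    exact (Sop_mono (q t) (Siter_pbox_subset hq lo hi t)).trans (Sop_pbox_subset (hq t) _ _)

/-- SIDE OF THE ORBIT BOX: if `a ≤ b + W` then `env a t − envLo b t ≤ shrink W t + width t` — the initial extent
contracts like a distance, the layers accumulate like the width. [folklore] -/
theorem env_sub_envLo_le {q : ℕ → ℕ} (hq : ∀ l, 0 < q l) {a b W : ℤ} (h : a ≤ b + W) (t : ℕ) :
    env q a t - envLo q b t ≤ shrink q W t + width q t := by
  have h1 := env_le_env_add_shrink hq h t
  have h2 := env_sub_envLo_le_width hq b t
  omega

/-- One layer widens a box by one index on each side. [folklore] -/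
theorem collar_pbox_subset (lo hi : Pt d) :
    collar (pbox lo hi) ⊆ pbox (fun i => lo i - 1) (fun i => hi i + 1) := by
  intro y hy
  obtain ⟨x, hx, hyx⟩ := Finset.mem_biUnion.mp hy
  rw [mem_pbox] at hx ⊢
  rw [mem_block] at hyx
  intro i
  have h1 := hx i
  have h2 := hyx i
  constructor <;> omega

/-- A domain inside a box of `≤ Nsz` indices per side satisfies condition (i) with size `Nsz`. [folklore] -/
theorem fitsIn_of_subset_pbox {S : Finset (Pt d)} {lo hi : Pt d} (h : S ⊆ pbox lo hi) {Nsz : ℕ}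
    (hw : ∀ i, hi i - lo i + 1 ≤ (Nsz : ℤ)) : B14BoxFix.FitsIn Nsz (↑S : Set (Pt d)) := by
  refine ⟨lo, fun y hy => ?_⟩
  have hy' := mem_pbox.1 (h (Finset.mem_coe.1 hy))
  intro i
  have h1 := hy' i
  have h2 := hw i
  show lo i ≤ y i ∧ y i ≤ lo i + (Nsz : ℤ) - 1
  constructor <;> omega

/-- Conversely, condition (i) with size `Nsz` puts the domain in a box of exactly `Nsz` indices per side. [folklore] -/
theorem exists_pbox_of_fitsIn {Nsz : ℕ} {S : Finset (Pt d)} (h : B14BoxFix.FitsIn Nsz (↑S : Set (Pt d))) :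
    ∃ lo hi : Pt d, S ⊆ pbox lo hi ∧ ∀ i, hi i = lo i + (Nsz : ℤ) - 1 := by
  obtain ⟨lo, hlo⟩ := h
  exact ⟨lo, fun i => lo i + (Nsz : ℤ) - 1, fun y hy => mem_pbox.2 (hlo (Finset.mem_coe.2 hy)), fun _ => rfl⟩

/-- TOUCHING A BOXED DOMAIN: if `X` satisfies (i) with size `100` and one of its cubes `a` touches `c`, every cube of
`X` is within sup-distance `100` of `c`. [cite: Balaban1989LargeFieldII, p.387 (lines 8-10)] -/
theorem near_of_condI_touch {X : Finset (Pt d)} (hXI : CondI 100 X) {a c : Pt d} (ha : a ∈ X) (hac : Touch a c) :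
    ∀ x ∈ X, ∀ i, c i - 100 ≤ x i ∧ x i ≤ c i + 100 := by
  obtain ⟨lo, hi, hb, hhi⟩ := exists_pbox_of_fitsIn hXI
  intro x hx i
  have h1 := mem_pbox.1 (hb hx) i
  have h2 := mem_pbox.1 (hb ha) i
  have h3 := hac i
  have h4 := hhi i
  push_cast at h4
  constructor <;> omega

/-! ## Part 3. The alternation arithmetic under the drop control -/

/-- NO TWO CONSECUTIVE STEPS FAIL TO GAIN on the horizon `m` under the drop control: for `l + 2 ≤ m`, `q_l ≥ 2` or
`q_{l+1} ≥ 2` (`DropCtl.lag_two`, `two_le_ratio_iff`). [cite: Balaban1989LargeFieldII, p.385 lines 1–3] -/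
theorem altGain_ratio {L : ℕ} (hL : 2 ≤ L) {σ : ℕ → ℕ} {m : ℕ} (hσ : DropCtl σ m) :
    ∀ l, l + 2 ≤ m → 2 ≤ ratio L σ l ∨ 2 ≤ ratio L σ (l + 1) := by
  intro l hl
  rw [two_le_ratio_iff hL, two_le_ratio_iff hL]
  show σ l ≤ σ (l + 1) ∨ σ (l + 1) ≤ σ (l + 2)
  have h1 := hσ.lag_two (i := l) hl
  omega

/-- The alternation restricts to a shifted window. [folklore] -/
theorem altGain_shift {q : ℕ → ℕ} {m : ℕ} (h : ∀ l, l + 2 ≤ m → 2 ≤ q l ∨ 2 ≤ q (l + 1)) (s : ℕ) :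
    ∀ l, l + 2 ≤ m - s → 2 ≤ q (s + l) ∨ 2 ≤ q (s + (l + 1)) :=
  fun l hl => h (s + l) (by omega)

/-- Under the alternation at least every other step gains: `⌊t/2⌋ ≤ gains t`. [cite: Balaban1989LargeFieldII, p.385 lines 1–3] -/
theorem div_two_le_gains_of_altGain {q : ℕ → ℕ} {m : ℕ} (h : ∀ l, l + 2 ≤ m → 2 ≤ q l ∨ 2 ≤ q (l + 1)) :
    ∀ t, t ≤ m → t / 2 ≤ gains q t
  | 0, _ => by simp [gains]
  | 1, _ => by simp
  | t + 2, ht => by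
    have ih := div_two_le_gains_of_altGain h t (by omega)
    have e : (t + 2) / 2 = t / 2 + 1 := by omega
    show (t + 2) / 2 ≤ gains q t + (if 2 ≤ q t then 1 else 0) + (if 2 ≤ q (t + 1) then 1 else 0)
    rcases h t ht with h1 | h1
    · rw [if_pos h1]
      generalize (if 2 ≤ q (t + 1) then 1 else 0) = u
      omega
    · rw [if_pos h1]
      generalize (if 2 ≤ q t then 1 else 0) = u
      omega

/-- THE LAYER WIDTH UNDER THE ALTERNATION: `width t ≤ 80` on the horizon, and `≤ 60` right after a gaining step (the
recursion `w ↦ ⌈w/q⌉ + 20`: a gaining step maps `≤ 80` to `≤ 40 + 20`, a non-gaining one follows a gaining one and maps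
`≤ 60` to `≤ 80`). [folklore] -/
theorem width_le_eighty {q : ℕ → ℕ} (hq : ∀ l, 0 < q l) {m : ℕ} (h : ∀ l, l + 2 ≤ m → 2 ≤ q l ∨ 2 ≤ q (l + 1)) :
    ∀ t, t ≤ m → width q t ≤ 80 ∧ ((t = 0 ∨ 2 ≤ q (t - 1)) → width q t ≤ 60)
  | 0, _ => by simp
  | t + 1, ht => by
    obtain ⟨ih1, ih2⟩ := width_le_eighty hq h t (by omega)
    have hw0 := width_nonneg hq t
    rw [width_succ, Nat.add_sub_cancel]
    by_cases hg : 2 ≤ q t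
    · have h1 : cdiv (width q t) (q t) ≤ 40 :=
        (cdiv_le_cdiv_two hg hw0).trans (cdiv_le_of_le_mul (by norm_num) (by omega))
      exact ⟨by omega, fun _ => by omega⟩
    · have hq1 : q t = 1 := by
        have := hq t
        omega
      have h60 : width q t ≤ 60 := by
        apply ih2
        rcases Nat.eq_zero_or_pos t with ht0 | ht0
        · exact Or.inl ht0
        · right
          rcases h (t - 1) (by omega) with h1 | h1
          · exact h1
          · exfalso
            rw [show t - 1 + 1 = t by omega] at h1
            omega
      rw [hq1, cdiv_one]
      refine ⟨by omega, ?_⟩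
      rintro (h0 | h2)
      · omega
      · omega

/-- A DISTANCE `≤ 99` CONTRACTS TO `≤ 13` AFTER THREE GAINING STEPS (`⌈99/8⌉ = 13`). [folklore] -/
theorem shrink_le_thirteen {q : ℕ → ℕ} (hq : ∀ l, 0 < q l) {W : ℤ} (hW0 : 0 ≤ W) (hW : W ≤ 99) {t : ℕ}
    (hg : 3 ≤ gains q t) : shrink q W t ≤ 13 := by
  refine (shrink_le_cdiv_pow hq hW0 t).trans ?_
  have h8 : (8 : ℤ) ≤ ((2 ^ gains q t : ℕ) : ℤ) := by
    have h := Nat.pow_le_pow_right (show 0 < 2 by norm_num) hg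
    norm_num at h
    exact_mod_cast h
  exact cdiv_le_of_le_mul (by positivity) (by linarith)

/-! ## Part 4. The horizon theorem (relative indices: time `0` = print's scale `j + 1 + K₁`) -/

/-- CONDITION (i) FOR THE MERGED DOMAIN AT EVERY LATE SCALE: `X` within sup-distance `D ≤ 128` of a cube `c ∈ Y`,
`S^{s}(Y)` in a cube of `100` per side ⇒ `S^{m}(X ∪ Y)` in a cube of `100` per side for all `m ≥ max(s + 6, 14)` on
the horizon — via `S^{m}(X ∪ Y) ⊆ (S^{m}(Y))^{~1}` (one-layer absorption) and the orbit box of `S^{s}(Y)`'s box, of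
side `≤ 13 + 80 + 3`. [cite: Balaban1989LargeFieldII, p.387 (lines 12-15)] -/
theorem condI_union {L : ℕ} (hL : 2 ≤ L) {σ : ℕ → ℕ} {m' : ℕ} (hσ : DropCtl σ m')
    {X Y : Finset (Pt d)} {c : Pt d} (hc : c ∈ Y) {D : ℤ} (hD : 0 ≤ D) (hD7 : D ≤ 128)
    (hX : ∀ x ∈ X, ∀ i, c i - D ≤ x i ∧ x i ≤ c i + D)
    {s : ℕ} (hY : CondI 100 (Siter (ratio L σ) s Y))
    {m : ℕ} (hsm : s + 6 ≤ m) (h14 : 14 ≤ m) (hm : m ≤ m') :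
    CondI 100 (Siter (ratio L σ) m (X ∪ Y)) := by
  have hq : ∀ l, 0 < ratio L σ l := fun l => ratio_pos (by omega) σ l
  obtain ⟨lo, hi, hYb, hhi⟩ := exists_pbox_of_fitsIn hY
  have hq' : ∀ l, 0 < (fun l => ratio L σ (s + l)) l := fun l => hq (s + l)
  obtain ⟨t, rfl⟩ : ∃ t, m = s + t := ⟨m - s, by omega⟩
  have hYt : Siter (ratio L σ) (s + t) Y ⊆
      pbox (fun i => envLo (fun l => ratio L σ (s + l)) (lo i) t) (fun i => env (fun l => ratio L σ (s + l)) (hi i) t) := by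
    rw [Siter_add (ratio L σ) s Y t]
    exact (Siter_subset_Siter _ hYb t).trans (Siter_pbox_subset hq' lo hi t)
  have hXt : Siter (ratio L σ) (s + t) X ⊆ collar (Siter (ratio L σ) (s + t) Y) := by
    refine one_layer_absorption_dropCtl hL hσ hc hD hX hm (hD7.trans ?_)
    have h7 : 7 ≤ (s + t) / 2 := by omega
    calc (128 : ℤ) = 2 ^ 7 := by norm_num
      _ ≤ 2 ^ ((s + t) / 2) := by exact_mod_cast Nat.pow_le_pow_right (by norm_num) h7
  have hZ : Siter (ratio L σ) (s + t) (X ∪ Y) ⊆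
      pbox (fun i => envLo (fun l => ratio L σ (s + l)) (lo i) t - 1)
        (fun i => env (fun l => ratio L σ (s + l)) (hi i) t + 1) := by
    rw [Siter_union]
    refine (Finset.union_subset hXt (subset_collar _)).trans ?_
    have h5 : collar (Siter (ratio L σ) (s + t) Y) ⊆
        collar (pbox (fun i => envLo (fun l => ratio L σ (s + l)) (lo i) t)
          (fun i => env (fun l => ratio L σ (s + l)) (hi i) t)) :=
      Finset.biUnion_subset_biUnion_of_subset_left _ hYt
    exact h5.trans (collar_pbox_subset _ _)
  have halt : ∀ l, l + 2 ≤ m' - s → 2 ≤ ratio L σ (s + l) ∨ 2 ≤ ratio L σ (s + (l + 1)) :=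
    altGain_shift (altGain_ratio hL hσ) s
  have hg3 : 3 ≤ gains (fun l => ratio L σ (s + l)) t := by
    have := div_two_le_gains_of_altGain (q := fun l => ratio L σ (s + l)) halt t (by omega)
    omega
  have hw : width (fun l => ratio L σ (s + l)) t ≤ 80 :=
    (width_le_eighty (q := fun l => ratio L σ (s + l)) hq' halt t (by omega)).1
  refine fitsIn_of_subset_pbox hZ fun i => ?_
  have h99 : hi i ≤ lo i + 99 := by
    have := hhi i
    push_cast at this
    omega
  have h1 := env_sub_envLo_le hq' h99 t
  have h2 : shrink (fun l => ratio L σ (s + l)) 99 t ≤ 13 := shrink_le_thirteen hq' (by norm_num) le_rfl hg3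
  show env (fun l => ratio L σ (s + l)) (hi i) t + 1 - (envLo (fun l => ratio L σ (s + l)) (lo i) t - 1) + 1 ≤
    ((100 : ℕ) : ℤ)
  push_cast
  omega

/-- THE STOPPING PROPERTY OF `Z = X ∪ Y` HOLDS AT `max(s + 6, 14) + N − 1` (inclusive reading of (ii), memory `N ≥ 1`,
the steps `1, …, m'` clean as on p. 384). [cite: Balaban1989LargeFieldII, p.387 (lines 12-15)] -/
theorem stopAt_union {L : ℕ} (hL : 2 ≤ L) {σ : ℕ → ℕ} {m' : ℕ} (hσ : DropCtl σ m')
    {X Y : Finset (Pt d)} {c : Pt d} (hc : c ∈ Y) {D : ℤ} (hD : 0 ≤ D) (hD7 : D ≤ 128)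
    (hX : ∀ x ∈ X, ∀ i, c i - D ≤ x i ∧ x i ≤ c i + D)
    {s : ℕ} (hY : CondI 100 (Siter (ratio L σ) s Y)) {N : ℕ} (hN : 1 ≤ N)
    (Clean : ℕ → Prop) (hclean : ∀ l, 1 ≤ l → l ≤ m' → Clean l) (hK : max (s + 6) 14 + N - 1 ≤ m') :
    StopAt 100 N Clean (fun l => Siter (ratio L σ) l (X ∪ Y)) (max (s + 6) 14 + N - 1) := by
  refine ⟨by omega, ?_, by omega, fun l h1 h2 => ⟨hclean l (by omega) (by omega), ?_⟩⟩
  · exact condI_union hL hσ hc hD hD7 hX hY (by omega) (by omega) hK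
  · exact condI_union hL hσ hc hD hD7 hX hY (by omega) (by omega) (by omega)

/-- HENCE THE STOPPING INDEX OF `Z` (the least one, `Nat.find`) IS AT MOST `max(s + 6, 14) + N − 1` in relative indices.
[cite: Balaban1989LargeFieldII, p.387 (lines 12-15)] -/
theorem find_stopAt_union_le {L : ℕ} (hL : 2 ≤ L) {σ : ℕ → ℕ} {m' : ℕ} (hσ : DropCtl σ m')
    {X Y : Finset (Pt d)} {c : Pt d} (hc : c ∈ Y) {D : ℤ} (hD : 0 ≤ D) (hD7 : D ≤ 128)
    (hX : ∀ x ∈ X, ∀ i, c i - D ≤ x i ∧ x i ≤ c i + D)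
    {s : ℕ} (hY : CondI 100 (Siter (ratio L σ) s Y)) {N : ℕ} (hN : 1 ≤ N)
    (Clean : ℕ → Prop) (hclean : ∀ l, 1 ≤ l → l ≤ m' → Clean l) (hK : max (s + 6) 14 + N - 1 ≤ m')
    [DecidablePred (StopAt 100 N Clean (fun l => Siter (ratio L σ) l (X ∪ Y)))]
    (hex : ∃ K, StopAt 100 N Clean (fun l => Siter (ratio L σ) l (X ∪ Y)) K) :
    Nat.find hex ≤ max (s + 6) 14 + N - 1 :=
  Nat.find_le (stopAt_union hL hσ hc hD hD7 hX hY hN Clean hclean hK)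

/-! ## Part 5. Absolute indices: the printed shape «K ≦ K₂ + n₁ + R_{j+1}» -/

/-- CONDITION (i) FOR `S^{m}(Z)`, `Z = X ∪ Y`, AT EVERY SCALE `m ≥ max(K₂ + 6, K₁ + 14)` ON THE HORIZON: `X, Y` touch
at the creation scale; `S^{K₁}(X)` satisfies (i) (`K₁ ≥ 1`); `S^{K₂}(Y)` satisfies (i); `K₁ ≤ K₂`.
[cite: Balaban1989LargeFieldII, p.387 (lines 8-15)] -/
theorem condI_merge {L : ℕ} (hL : 2 ≤ L) {σ : ℕ → ℕ} {m' : ℕ} (hσ : DropCtl σ m')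
    {X Y : Finset (Pt d)} {a₀ c₀ : Pt d} (ha₀ : a₀ ∈ X) (hc₀ : c₀ ∈ Y) (h₀ : Touch a₀ c₀)
    {K₁ K₂ : ℕ} (hK₁ : 1 ≤ K₁) (h12 : K₁ ≤ K₂)
    (hXI : CondI 100 (Siter (ratio L σ) K₁ X)) (hYI : CondI 100 (Siter (ratio L σ) K₂ Y))
    {m : ℕ} (h₂ : K₂ + 6 ≤ m) (h₁ : K₁ + 14 ≤ m) (hm : m ≤ m') :
    CondI 100 (Siter (ratio L σ) m (X ∪ Y)) := by
  have hq : ∀ l, 0 < ratio L σ l := fun l => ratio_pos (by omega) σ l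
  obtain ⟨e, heX, heY⟩ := exists_common_Siter hq ha₀ hc₀ h₀ hK₁
  have hX := near_of_condI_touch hXI heX (Touch.refl e)
  obtain ⟨t, rfl⟩ : ∃ t, m = K₁ + t := ⟨m - K₁, by omega⟩
  obtain ⟨s, rfl⟩ : ∃ s, K₂ = K₁ + s := ⟨K₂ - K₁, by omega⟩
  rw [Siter_add, ratio_shift_fun, Siter_union]
  rw [Siter_add, ratio_shift_fun] at hYI
  exact condI_union hL (dropCtl_shift hσ K₁) heY (by norm_num) (by norm_num) hX hYI (by omega) (by omega) (by omega)

/-- THE STOPPING PROPERTY OF `Z = X ∪ Y` (memory `N ≥ 1`, steps `1, …, m'` clean) HOLDS AT `max(K₂ + 6, K₁ + 14) + N − 1`,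
given the stopping data of `X` at `K₁` and of `Y` at `K₂ ≥ K₁` (any memories, any cleanliness predicates — only their
condition (i) at `K₁`, `K₂` is used). [cite: Balaban1989LargeFieldII, p.387 (lines 8-15)] -/
theorem stopAt_merge {L : ℕ} (hL : 2 ≤ L) {σ : ℕ → ℕ} {m' : ℕ} (hσ : DropCtl σ m')
    {X Y : Finset (Pt d)} {a₀ c₀ : Pt d} (ha₀ : a₀ ∈ X) (hc₀ : c₀ ∈ Y) (h₀ : Touch a₀ c₀)
    {N₁ N₂ : ℕ} {Clean₁ Clean₂ : ℕ → Prop} {K₁ K₂ : ℕ} (h12 : K₁ ≤ K₂)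
    (hX : StopAt 100 N₁ Clean₁ (fun l => Siter (ratio L σ) l X) K₁)
    (hY : StopAt 100 N₂ Clean₂ (fun l => Siter (ratio L σ) l Y) K₂)
    {N : ℕ} (hN : 1 ≤ N) (Clean : ℕ → Prop) (hclean : ∀ l, 1 ≤ l → l ≤ m' → Clean l)
    (hK : max (K₂ + 6) (K₁ + 14) + N - 1 ≤ m') :
    StopAt 100 N Clean (fun l => Siter (ratio L σ) l (X ∪ Y)) (max (K₂ + 6) (K₁ + 14) + N - 1) := by
  have hK₁ : 1 ≤ K₁ := hX.1
  refine ⟨by omega, ?_, by omega, fun l h1 h2 => ⟨hclean l (by omega) (by omega), ?_⟩⟩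
  · exact condI_merge hL hσ ha₀ hc₀ h₀ hK₁ h12 hX.2.1 hY.2.1 (by omega) (by omega) hK
  · exact condI_merge hL hσ ha₀ hc₀ h₀ hK₁ h12 hX.2.1 hY.2.1 (by omega) (by omega) (by omega)

/-- «K ≦ K₂ + n₁ + R_{j+1}» IN THE INDEX MODEL: the stopping index of the merged domain `Z = X ∪ Y` (memory `N`,
print's `R_{j+1}`) is at most `max(K₂ + 6, K₁ + 14) + N − 1`. [cite: Balaban1989LargeFieldII, p.387 (lines 12-15)] -/
theorem find_stopAt_merge_le {L : ℕ} (hL : 2 ≤ L) {σ : ℕ → ℕ} {m' : ℕ} (hσ : DropCtl σ m')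
    {X Y : Finset (Pt d)} {a₀ c₀ : Pt d} (ha₀ : a₀ ∈ X) (hc₀ : c₀ ∈ Y) (h₀ : Touch a₀ c₀)
    {N₁ N₂ : ℕ} {Clean₁ Clean₂ : ℕ → Prop} {K₁ K₂ : ℕ} (h12 : K₁ ≤ K₂)
    (hX : StopAt 100 N₁ Clean₁ (fun l => Siter (ratio L σ) l X) K₁)
    (hY : StopAt 100 N₂ Clean₂ (fun l => Siter (ratio L σ) l Y) K₂)
    {N : ℕ} (hN : 1 ≤ N) (Clean : ℕ → Prop) (hclean : ∀ l, 1 ≤ l → l ≤ m' → Clean l)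
    (hK : max (K₂ + 6) (K₁ + 14) + N - 1 ≤ m')
    [DecidablePred (StopAt 100 N Clean (fun l => Siter (ratio L σ) l (X ∪ Y)))]
    (hex : ∃ K, StopAt 100 N Clean (fun l => Siter (ratio L σ) l (X ∪ Y)) K) :
    Nat.find hex ≤ max (K₂ + 6) (K₁ + 14) + N - 1 :=
  Nat.find_le (stopAt_merge hL hσ ha₀ hc₀ h₀ h12 hX hY hN Clean hclean hK)

/-- The same in print's shape with `n₁ = 13`: `K ≤ K₂ + 13 + N`. [cite: Balaban1989LargeFieldII, p.387 (lines 12-15)] -/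
theorem find_stopAt_merge_le' {L : ℕ} (hL : 2 ≤ L) {σ : ℕ → ℕ} {m' : ℕ} (hσ : DropCtl σ m')
    {X Y : Finset (Pt d)} {a₀ c₀ : Pt d} (ha₀ : a₀ ∈ X) (hc₀ : c₀ ∈ Y) (h₀ : Touch a₀ c₀)
    {N₁ N₂ : ℕ} {Clean₁ Clean₂ : ℕ → Prop} {K₁ K₂ : ℕ} (h12 : K₁ ≤ K₂)
    (hX : StopAt 100 N₁ Clean₁ (fun l => Siter (ratio L σ) l X) K₁)
    (hY : StopAt 100 N₂ Clean₂ (fun l => Siter (ratio L σ) l Y) K₂)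
    {N : ℕ} (hN : 1 ≤ N) (Clean : ℕ → Prop) (hclean : ∀ l, 1 ≤ l → l ≤ m' → Clean l)
    (hK : max (K₂ + 6) (K₁ + 14) + N - 1 ≤ m')
    [DecidablePred (StopAt 100 N Clean (fun l => Siter (ratio L σ) l (X ∪ Y)))]
    (hex : ∃ K, StopAt 100 N Clean (fun l => Siter (ratio L σ) l (X ∪ Y)) K) :
    Nat.find hex ≤ K₂ + 13 + N := by
  have h := find_stopAt_merge_le hL hσ ha₀ hc₀ h₀ h12 hX hY hN Clean hclean hK hex
  have hK₁ : 1 ≤ K₁ := hX.1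
  omega

end

end Literature.MathematicalPhysics.QuantumFieldTheory.Balaban1983to89.B16MergeHorizon
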